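import Summits.BirchSwinnertonDyer.BirchSwinnertonDyer.Theorems.ByReductionTypeAtTwoRankOneAtTwoBigImageOddLocalOneDoorSubsliceFirstLayerManinFree
import Literature.NumberTheory.EllipticCurves.BSDSelmerSmithHigherSelmerRankLaws
import HarnessLib

/-!
# ES-44 — SPIN AT `3`-CYCLE DOORS: the `±` object at `2` on the identity component is a Cassels–Tate bit, and it is NOT a
`2`-adic Kummer–Frobenius datum (lens -es, cell bsd-f1-sign2, gen 35; bears on crux `ByReductionTypeAtTwo.RankOneAtTwoBigImageOddLocal`,
item 23715, through the line of record's residue `R_N = DoorIndexLawFullCAtTwoSomeDoorResidueNonEgg`)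

**Population (the identity-component residual of the crux).** `W/ℚ` globally minimal, non-CM, `ρ_{W,2^n}` onto, odd torsion, odd Tamagawa,
analytic rank `1`, `Δ_W > 0`, `Ш(W)[2] = 0`, `E(ℚ) ⊂ E⁰(ℝ)` (`¬ MeetsEgg W`).  Examples `359a1 = [1,0,1,-23,39]`, `359b1`.  Here EVERY Heegner
door has EVEN Heegner index (AN-40z), the bottom rung and ES-43's certificate `IDC∃` are silent, and the PROVED egg twist law
(`GenusKolyArch.eggTwistLawAtTwo_holds`) gives `#Sel₂(W^{(d)}) = 4` at every desc-admissible `d`: the FROZEN PLANE `⟨κ_g, b_W⟩ ⊂ H¹(ℚ, W[2])`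
(`κ_g` the Kummer class of the generator, `b_W` the phantom class: Selmer at all finite places, `loc_∞ b_W = T₀`, the identity-component
`2`-torsion point; forced by `dim Sel^{rel ∞} = dim Sel^{str ∞} + 1` and Monsky parity).

**Mechanism (what the `±` at `2` IS here).**  At a `3`-cycle prime door `d = -ℓ` (all door primes have `a_q` odd) the twist `W^{(d)}` has
`Sel₂ = ⟨κ_g, b_W⟩` and the ONLY remaining invariant is the Cassels–Tate bit `β_W(d) := CT_{W^{(d)}}(κ_g, b_W) ∈ 𝔽₂`, i.e. SPIN-NONDEGENERATE
`⟺ r_4(W^{(d)}) = 0` (`twistSelmerTorsionRankPow W 2 d = 0`, Smith's `r_{2^k}`) `⟺ Ш(W^{(d)})[2^∞] ≅ (ℤ/2)²` and rank `0`;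
SPIN-DEGENERATE `⟺ r_4 = 2 ⟺` rank `2` or `Ш(W^{(d)}) ⊇ (ℤ/4)²`.  Under `BSD₂` the bit is the Heegner index: `v₂ I_d = 1 ⟺ β = 1`
(-an §26.5, T-SEL 22/22 on `359a1`).  The Euler system at `2` on this class must be run at `β = 1` doors (depth exactly one).
THREE facts about `β`, one typed conjecture, one kernel reduction:
* (census44, THIS FILE's data fact `SpinBitNotKummerFrobenianAtLevel32At359a1`) `β` is NOT a function of the conjugacy class of `Frob_ℓ` in
  `Gal(ℚ(W[32], 32⁻¹E(ℚ))/ℚ)`: over a `3`-cycle, that class is `(a_ℓ mod 32, ℓ mod 32)` (the lift ambiguity `W[2^k]/(Frob−1)` vanishes and the torus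
  class is `(tr, det)`), and `ℓ = 619, 1163` (`a = 33, −31`; `ℓ ≡ 11 (32)`, `a ≡ 1 (32)`, even `a ≡ a' (64)`) have `β = 0, 1`.  Torus levels `8/16`,
  `16/32` refuted likewise; `h(−ℓ) mod 16`, `Cl(−4·359·ℓ)[2^∞]`, `Cl(−8ℓ)[2^∞]` refuted as governors (census44.out).  -an §26.5 had level `(4, 8)`.
* (Kramer 1981 Thm. 2, p. 132–133) the norm `Cor : Sel₂(E/K_d) → Sel₂(E/ℚ) ∩ Sel₂(E^{(d)}/ℚ) = ⟨κ_g⟩` is ONTO (`Φ/NS'` is even-dimensional and `Φ` is a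
  line): complex conjugation ALWAYS has exactly one Jordan block on `Sel₂(E/K_d) ≅ 𝔽₂³` — the Jordan type is NOT the bit (a dead reformulation, recorded).
* (lift count) a governing field CAN only see `β` through `Frob`-FIXED composition factors of its `2`-group over `ℚ(W[2])`: quadratic characters
  (`ℓ mod 8`: refuted alone), the torus (refuted to level `32`), and CENTRAL factors `Λ²(W[2]) = 𝔽₂` of a Heisenberg-type extension
  `1 → 𝔽₂ → P → W[2] ⊕ W[2] → 1` over the compositum `L_W = ℚ(W[2], ½g, F_{b_W})` of the two `S₄`-fields of the frozen plane — the field that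
  trivialises the cup product `κ_g ∪ b_W = 0 ∈ Br(ℚ)[2]` (all local cup products of Selmer classes vanish).  In such an `M_W` the bit is the ORDER of
  `Frob_ℓ` (`3` versus `6`) and it flips inside every central coset, so its Chebotarev density among `3`-cycle primes is EXACTLY `1/2`
  (census44: spin-degenerate `15/33 = 0.45` on `359a1`, counting the `11` rank-`2` doors as degenerate, as they must be).
HENCE the typed conjecture `SpinGovernsCasselsTateBitAtTwo` (a SECOND-ORDER Frobenian law, polynomial form: `β(ℓ) = 1 ⟺ P̄ ∤ X^{ℓ³} − X` for one
`P ∈ ℤ[X]`, predicted splitting field `M_W`, degree `| 192`, unramified outside `2N∞`), its consequence `SpinDoorDensityHalfAtTwo`, the supply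
`SpinDoorExistsAtTwo` (S1), the one-bit index law `SpinDoorHeegnerExponentAtTwo` (S2: exponent `v₂(c)+1` at spin-nondegenerate prime doors; GZ+BSD-strength,
Kolyvagin-sharp-bound ∧ Kolyvagin-nonvanishing at `2`, depth one), the Selmer-algebra support `ShaCardFourAtSpinDoorAtTwo` (S3), and the KERNEL REDUCTION
`residueNonEgg_of_spinDoors : S1 → S2 → S3 → R_N` (modulo modularity only): the line of record's `Δ > 0` non-egg residue IS «find a spin door and prove
depth-one exactness there».

VERSION v4 (-es g37, 2026-08-31T09:45Z): v3 (0cfa6a8ab996e123, commit 4a68f77f39fe, AUDITED REF1 §448: survive, BC7 CLEAN) + rider R448a (non-constancy clause inside `∃ P` of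
`SpinGovernsCasselsTateBitAtTwo`); every other byte unchanged.  VERSION v3 (gen 36, 2026-08-31T08:00Z): v2 (4c03406cd227bc02, commit 93031fa66ece, AUDITED REF1 §445) + rider R445a (`2 ≤ P.natDegree` in S-gov);
every other byte unchanged.  VERSION v2 (gen 36, 2026-08-31; v1 = b106e1fa6abfead6, commit 726d6cdab563, AUDITED REF1 §434: 6/6 survive, BC7 6/6 CLEAN).  Riders applied:
R434b — S2 `SpinDoorHeegnerExponentAtTwo` gains the binder `L(W^{(d_K)},1) ≠ 0` (v1 silently asserted the rank-`0` `2`-converse at every spin door);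
R434a — S3 `ShaCardFourAtSpinDoorAtTwo` loses its unnecessary `L ≠ 0` binder; R434d — `SpinGovernsCasselsTateBitAtTwo` asks for `Irreducible P`
(one Galois field).  The kernel reduction `residueNonEgg_of_spinDoors` is unchanged in shape (S1 supplies `L ≠ 0` to S2).  REF2 P-es-44 (placement
register HOME/REF2-PLACEMENT-v72-add27.md): nearest print Smith 2016 Thm. 3.2 stands; ES-44′ density `1/2` and the level-`32` Kummer exclusion NOT IN PRINT;
S2 = Kolyvagin exactness at `2` in depth one (Kolyvagin 1991 «On the structure of Selmer groups», Math. Ann. 291, Thm. 1 — `p` odd in print); S3 in-print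
assembly.  The Ш-residue companion (egg class with `#Ш(W)[2^∞] = 4`, INHERITED plane `Ш(W)[2]`, depth two) is ES-45, file `ShaSpinAtTwoES45.lean`.

PLACEMENT (searched 2026-08-31, corpus fts+vec + galaxy; see MEMO-es §44).  NEAREST PRINT: A. Smith, «Governing fields and statistics for 4-Selmer
groups and 8-class groups» (arXiv:1607.07860), Thm. 3.2 [corpus:arxiv-1607.07860 p0008–p0009]: for an abelian variety WITH FULL RATIONAL `2`-TORSION and FIXED
classes `F, F'`, `⟨F,F'⟩_{A^{(d₁)}} = ⟨F,F'⟩_{A^{(d₂)}} + [ (L/K) / 𝔡 ]` for `d₁/d₂` a square at `S ⊇ {bad, 2, ∞}`, with `K` the field trivialising `F, F'` and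
`L/K` QUADRATIC ramified only above `S` — exactly the central-quadratic shape predicted here.  `SpinGovernsCasselsTateBitAtTwo` is the conjectural EXTENSION of
that theorem to `E[2](ℚ) = 0` with `S₃` image (where `K = L_W` is non-abelian of degree `96` and only `3`-CYCLE primes carry the frozen plane), read at prime
twists: `β(ℓ₁) = β(ℓ₂) ⟺ Frob_{ℓ₁}³ = Frob_{ℓ₂}³ ∈ Gal(M_W/L_W)` for `ℓ₁ ≡ ℓ₂ (mod 8)`.  Other neighbours: governing fields for the `8`- and `16`-ranks of
`Cl(ℚ(√−ℓ))` (Rédei, Cohn–Lagarias, Stevenhagen, Koymans–Milovic), Smith's `2^k`-Selmer distribution in twist grids (tree `smith2026_twoPowerSelmerRanks_markov`),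
Kriz–Li 2019 (split `2`, Rem. 1.14).  NOT FOUND in print: the `S₃`-image prime-twist law, its failure inside the `2`-adic Kummer tower (level `32`, this file),
and the reduction of the Heegner `2`-index residue `R_N` to spin doors.  Nearest in the cell: -an §26.5/§26.7(b) (the bit as a `4`-Selmer event,
level-`(4,8)` non-Frobenian, «sub-crux for 23715»); THIS FILE adds the level-`32` torus exclusion, the Kramer no-go, the Heisenberg shape with its
density-`1/2` law, and the kernel reduction of `R_N`.
PARTITION 52421 = 17880+27650+3440+3451 unchanged · tree 60cbd0490886c010 · beyond-print theorem: no (statements, a data fact, kernel glue) · BSD not proved.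
-/

noncomputable section

open scoped Classical
open Polynomial Filter Topology

set_option linter.dupNamespace false
set_option autoImplicit false

namespace Summit.BirchSwinnertonDyer.BirchSwinnertonDyer.Theorems.RankOneAtTwoSpinAtTwo

open WeierstrassCurve NumberField Literature.NumberTheory.EllipticCurves Literature.NumberTheory.EllipticCurves.ModularForms
  Summit.BirchSwinnertonDyer.Rank1Residual.F1Sign2
  Summit.BirchSwinnertonDyer.BirchSwinnertonDyer.Theorems
  Summit.BirchSwinnertonDyer.BirchSwinnertonDyer.Theorems.RankOneAtTwoOneDoor

/-! ## §0 Vocabulary (over tree declarations only) -/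

/-- `ℓ` is a `3`-CYCLE HEEGNER DOOR PRIME of `W`: `ℓ` prime and `d = -ℓ` is desc-admissible (`d ≡ 1 (mod 8)`, tree `DescAdmissible`: every door prime
good with `a_q` odd, Heegner hypothesis at the bad primes) or unramified-desc-admissible (`d ≡ 5 (mod 8)`, `2` good, tree `DescAdmissibleUnram`).
Both `2`-splitting types: the spin phenomenon is blind to `ℓ mod 8` (census44: `ℓ ≡ 3 (8)`: `NNNNNDDDNNN`, `ℓ ≡ 7 (8)`: `NDNNNNNNNNN`). -/
def IsThreeCycleDoorPrime (W : WeierstrassCurve ℚ) [W.IsGloballyMinimal] (ℓ : ℕ) : Prop :=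
  ℓ.Prime ∧ (DescAdmissible W (-(ℓ : ℤ)) ∨ DescAdmissibleUnram W (-(ℓ : ℤ)))

/-- SPIN-NONDEGENERATE at `d`: `r_4(W^{(d)}) = 0` — no `ℤ/4` inside `Sel_{2^∞}(W^{(d)}/ℚ)` (Smith's `r_{2^k}`, tree `twistSelmerTorsionRankPow`).
On the frozen plane (`r_2 = 2`) this says: rank `0` and the Cassels–Tate pairing on `Ш(W^{(d)})[2] = ⟨κ_g, b_W⟩ ≅ (ℤ/2)²` is non-degenerate
(`Ш[2^∞] = Ш[2]`); its negation: rank `2`, or `Ш(W^{(d)}) ⊇ (ℤ/4)²`.  [cite: SmithGoldfeld2025, Notation 1.8] -/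
def SpinNondegenerateAt (W : WeierstrassCurve ℚ) (d : ℤ) : Prop :=
  twistSelmerTorsionRankPow W 2 d = 0

/-- «the Frobenius of `ℓ` in the splitting field of `P` has order NOT dividing `3`», in polynomial currency: `P mod ℓ` does NOT divide
`X^{ℓ³} − X` (the product of all monic irreducibles of degree `1` or `3` over `𝔽_ℓ`).  For `P` the minimal polynomial of a primitive element of a
Galois field `M`, and `ℓ` unramified of residue degree `f`: this is `f ∤ 3`. -/
def FrobeniusOrderNotDvdThree (P : ℤ[X]) (ℓ : ℕ) : Prop :=
  ¬ (P.map (Int.castRingHom (ZMod ℓ)) ∣ ((X : (ZMod ℓ)[X]) ^ (ℓ ^ 3) - X))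

/-! ## §1 The `±` object: a second-order Frobenian law for the Cassels–Tate bit (CONJECTURE of this lens) and what the data already excludes -/

/-- **ES-44 `SpinGovernsCasselsTateBitAtTwo` (CONJECTURE; the lens's typed candidate).**  For `W` in the identity-component class there is ONE
non-zero integer polynomial `P` (predicted: a primitive element of the Heisenberg field `M_W ⊃ ℚ(W[2], ½g, F_{b_W})`, `[M_W:ℚ] ∣ 192`, unramified
outside `2·N_W·∞`) such that for all but finitely many `3`-cycle Heegner door primes `ℓ`:
`r_4(W^{(−ℓ)}) = 0 ⟺ (P mod ℓ) ∤ X^{ℓ³} − X` — the Cassels–Tate bit of the prime twist is the ORDER OF FROBENIUS bit of a fixed finite Galois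
extension.  It is NOT a first-order law: no `P` whose splitting field lies in the `2`-adic Kummer tower `ℚ(W[2^∞], 2^{-∞}E(ℚ))` can work below level
`64` (`SpinBitNotKummerFrobenianAtLevel32At359a1`).  Why it might fail: the bit could be genuinely non-Frobenian (like the `32`-rank of `Cl(−4ℓ)` is
expected to be), i.e. governed only by a Rédei-type symbol whose field grows with `ℓ`; the `18/22` bias of rank-`0` doors on `359a1` is then
unexplained by Chebotarev.  Cheapest falsifier: two `3`-cycle door primes of `359a1` with the same Frobenius class in the (computable, degree-`192`)
candidate `M_W` and different `ellrank` verdicts (data ask D-es-112).  v2 (gen 36, REF1 §434 rider R434d): `Irreducible P` replaces `P ≠ 0` — ONE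
Galois field is meant (a reducible / non-squarefree `P` would let the `∃ P`-form encode «β eventually constant»). [cite: SmithGoldfeld2025, Notation 1.8] [cite: Smith2022SelmerTwistI, Thm. 1.5 (grid
distribution; shape only)] [cite: Kramer1981, Thm. 2]   v3 (gen 36, REF1 §445 rider R445a): `2 ≤ P.natDegree` added — a linear `P` would make the bit eventually
constant (governing field `ℚ`); ONE non-trivial Galois field is meant. v4 (gen 37, REF1 §448 rider R448a = REF1's self-correction of R445a): a NON-CONSTANCY clause is added inside `∃ P` — the Frobenius-order bit of `P` takes BOTH values on `3`-cycle door primes beyond every bound.  Reason (REF1 K448.5): every `3`-cycle door prime is `ℓ ≡ 3 (mod 4)`, so `P₊ = X² + 1` passes the guard `Irreducible P ∧ 2 ≤ P.natDegree` with `FrobeniusOrderNotDvdThree P₊ ℓ` TRUE at every door prime (and `X² − Δ_W` with it FALSE at every door prime): without the clause the `∃ P`-form still encoded «`β_W` eventually constant».  The clause holds for the predicted central-quadratic governing field by Chebotarev and fails for every door-congruence `P`; eventual constancy of `β_W` is now EXCLUDED by the statement (it contradicts the density-`½` companion anyway). -/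
@[conjecture] def SpinGovernsCasselsTateBitAtTwo : Prop :=
  ∀ (W : WeierstrassCurve ℚ) [W.IsElliptic] [W.IsGloballyMinimal],
    ¬ W.HasCM → (∀ n : ℕ, W.HasSurjectiveModNGaloisRep ((2 ^ n : ℕ) : ℤ)) → W.analyticRank = 1 →
    0 < W.Δ → ShaTwoTrivial W → ¬ MeetsEgg W →
    ∃ P : ℤ[X], Irreducible P ∧ 2 ≤ P.natDegree ∧
      (∀ B' : ℕ, ∃ ℓ₁ ℓ₂ : ℕ, B' < ℓ₁ ∧ B' < ℓ₂ ∧ IsThreeCycleDoorPrime W ℓ₁ ∧ IsThreeCycleDoorPrime W ℓ₂ ∧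
        FrobeniusOrderNotDvdThree P ℓ₁ ∧ ¬ FrobeniusOrderNotDvdThree P ℓ₂) ∧
      ∃ B : ℕ, ∀ ℓ : ℕ, B < ℓ → IsThreeCycleDoorPrime W ℓ →
      (SpinNondegenerateAt W (-(ℓ : ℤ)) ↔ FrobeniusOrderNotDvdThree P ℓ)

/-- **ES-44′ `SpinDoorDensityHalfAtTwo` (CONJECTURE; the quantitative shadow of the Heisenberg shape).**  In the identity-component class the
spin-nondegenerate `3`-cycle door primes have relative natural density EXACTLY `1/2` among all `3`-cycle door primes (the central bit flips inside every
coset of the centre, whatever the class function).  Census44 (`359a1`, `ℓ < 1200`): `18` nondegenerate / `33` = `0.545` (the `11` rank-`2` doors are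
degenerate by force: `(ℤ/4)² ↪ E^{(d)}(ℚ) ⊗ ℚ₂/ℤ₂`).  Why it might fail: a biased class function on a NON-Heisenberg governing group, or no density.
[cite: Smith2022SelmerTwistI, Thm. 1.5 (shape only)] [cite: Kramer1981, Prop. 6] -/
@[conjecture] def SpinDoorDensityHalfAtTwo : Prop :=
  ∀ (W : WeierstrassCurve ℚ) [W.IsElliptic] [W.IsGloballyMinimal],
    ¬ W.HasCM → (∀ n : ℕ, W.HasSurjectiveModNGaloisRep ((2 ^ n : ℕ) : ℤ)) → W.analyticRank = 1 →
    0 < W.Δ → ShaTwoTrivial W → ¬ MeetsEgg W →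
    Tendsto (fun X : ℕ =>
      (((Finset.range X).filter fun ℓ => IsThreeCycleDoorPrime W ℓ ∧ SpinNondegenerateAt W (-(ℓ : ℤ))).card : ℝ) /
        (((Finset.range X).filter fun ℓ => IsThreeCycleDoorPrime W ℓ).card : ℝ)) atTop (𝓝 (1 / 2 : ℝ))

/-- **DATA FACT `SpinBitNotKummerFrobenianAtLevel32At359a1` (census44 + -an T-SEL j331759; two engines for `a_ℓ`: census44 point count and PARI; ONE engine
for the bit: PARI `ellrank` — second engine asked, D-es-113).**  On `W = 359a1`: `ℓ = 619` and `ℓ' = 1163` are `3`-cycle Heegner door primes (`d ≡ 5 (8)`),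
`a_619 = 33`, `a_1163 = −31` — congruent modulo `64` — and `619 ≡ 1163 (mod 32)`, so `Frob_619` and `Frob_1163` are conjugate in
`Gal(ℚ(W[32], 32⁻¹E(ℚ))/ℚ)`; yet `r_4(W^{(−619)}) = 2` (`ellrank [0,2,0]`, CT-degenerate) and `r_4(W^{(−1163)}) = 0` (`ellrank [0,0,2]`).  Stated as a
`Prop` (the Selmer side is not kernel-computable; tagged as an open node so the audit does not read it as a vendored fact); evidence
`Cruxes/RankOneAtTwoBigImageOddLocal/CensusES44.md`. [cite: Kramer1981, Prop. 6] -/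
@[conjecture] def SpinBitNotKummerFrobenianAtLevel32At359a1 : Prop :=
  ∀ (W : WeierstrassCurve ℚ) [W.IsElliptic] [W.IsGloballyMinimal], W = ⟨1, 0, 1, -23, 39⟩ →
    IsThreeCycleDoorPrime W 619 ∧ IsThreeCycleDoorPrime W 1163 ∧
      W.frobeniusTrace 619 = 33 ∧ W.frobeniusTrace 1163 = -31 ∧ (33 : ℤ) ≡ -31 [ZMOD 64] ∧ (619 : ℤ) ≡ 1163 [ZMOD 32] ∧
      ¬ SpinNondegenerateAt W (-619) ∧ SpinNondegenerateAt W (-1163)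

/-- The two congruences of the data fact, kernel-checked (the arithmetic half of «same Frobenius class at level 32»). -/
theorem level32_congruences : (33 : ℤ) ≡ -31 [ZMOD 64] ∧ (619 : ℤ) ≡ 1163 [ZMOD 32] := by decide

/-! ## §2 The Euler-system reading: spin doors, the one-bit index law, and the kernel reduction of the line of record's residue `R_N` -/

/-- **S1 `SpinDoorExistsAtTwo` (CONJECTURE; supply).**  Every `W` of the identity-component class has an imaginary quadratic `K = ℚ(√−ℓ)` with `d_K = −ℓ`
DESC-admissible (`ℓ ≡ 7 (mod 8)`, `a_ℓ` odd, Heegner), coprime to `N_W`, Heegner hypothesis, SPIN-NONDEGENERATE (`r_4(W^{(d_K)}) = 0`) and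
`L(W^{(d_K)}, 1) ≠ 0`.  Follows from `SpinGovernsCasselsTateBitAtTwo` + Chebotarev (density `1/2`) + the rank-`0` `2`-converse (spin-nondegenerate forces
`Sel_{2^∞}` finite).  BC5 witness: `359a1`, `ℓ = 7` (`a_7 = 1`, `ellrank [0,0,2]`, analytic rank `0`; census44 row 1); ten of the eleven rank-`0`
`ℓ ≡ 7 (8)` doors of `359a1` below `1200` qualify.  Why it might fail: only through a systematic vanishing `L(W^{(−ℓ)},1) = 0` on the whole spin-nondegenerate
class, which `r_4 = 0` itself forbids under BSD. [cite: Kramer1981, Prop. 6] [cite: MazurRubin2010, Prop. 3.3] [cite: SmithGoldfeld2025, Notation 1.8] -/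
@[conjecture] def SpinDoorExistsAtTwo : Prop :=
  ∀ (W : WeierstrassCurve ℚ) [W.IsElliptic] [W.IsGloballyMinimal] [NeZero (W.conductorNorm ℤ)],
    ¬ W.HasCM → (∀ n : ℕ, W.HasSurjectiveModNGaloisRep ((2 ^ n : ℕ) : ℤ)) → Odd W.torsionOrder → Odd W.tamagawaProduct →
    W.analyticRank = 1 → 0 < W.Δ → ShaTwoTrivial W → ¬ MeetsEgg W →
    ∃ (K : Type) (_ : Field K) (_ : NumberField K), IsImaginaryQuadratic K ∧ DescAdmissible W (NumberField.discr K) ∧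
      Nat.Coprime (NumberField.discr K).natAbs (W.conductorNorm ℤ) ∧ SatisfiesHeegnerHypothesis (W.conductorNorm ℤ) K ∧
      SpinNondegenerateAt W (NumberField.discr K) ∧ (W.quadraticTwist (NumberField.discr K : ℚ)).entireLFunction 1 ≠ 0

/-- **S2 `SpinDoorHeegnerExponentAtTwo` (CONJECTURE; THE ONE-BIT INDEX LAW = depth-one Kolyvagin exactness at `2` on the identity component).**  `W` in the
class; `K` imaginary quadratic with `d_K` desc-admissible, coprime to `N_W`, Heegner, SPIN-NONDEGENERATE; `Dt` ANY parametrisation datum (constant `c`),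
`H`, `ι`, `P ∈ E(K)` over the complex Heegner point.  THEN the exact `2`-divisibility exponent of `P` modulo torsion is `v₂(c) + 1`: the Heegner point is
twice a non-divisible point and no more.  `⟸` (Kolyvagin's bound at `2` with sharp constant: `y_K ∉ 4E(K)+tors ⟹ #Ш(E/K)[2^∞] ≤ 4`) ∧ (Kolyvagin
non-vanishing at `2`, depth one: `Ш(W^{(d)})[2^∞] = (ℤ/2)² ⟹ y_K ∉ 4E(K) + tors`); `= BSD₂(W) ∧ BSD₂(W^{(d)})` read at the door through the tree's
`P2.bsdp_two_iff_of_heegner_rankOne`.  The analogue of R₀⁺ `HeegnerExponentAtSelmerTrivialMinimalDoorAtTwo` one layer up.  Census (BSD-reading): -an T-SEL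
`359a1` 22/22 (`ellrank [0,0,2] ⟺ c̃ odd ⟺ v₂ I = 1`).  Why it might fail: Kolyvagin's conjecture at the prime `2` in depth one; a `2`-power discrepancy of a
non-optimal datum (`c` even).  v2 (gen 36, REF1 §434 rider R434b): the binder `L(W^{(d_K)}, 1) ≠ 0` is ADDED — without it the statement also asserted the
rank-`0` `2`-converse at every spin door (at a door with `L(W^{(d_K)},1) = 0` the Heegner point is torsion and `HasTwoDivisibilityUpToTorsion` is false);
the kernel reduction still composes because S1 supplies `L ≠ 0`. [cite: Kolyvagin1990, Thm. A] [cite: GrossLMS1991, Conj. 1.2, §3 and §10]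
[cite: Zhang2014CJM, Thm. 1.1 (p ≥ 5; shape only)] [cite: GrossZagier1986, Thm. I.6.3 and V.§2] -/
@[conjecture] def SpinDoorHeegnerExponentAtTwo : Prop :=
  ∀ (W : WeierstrassCurve ℚ) [W.IsElliptic] [W.IsGloballyMinimal] [NeZero (W.conductorNorm ℤ)],
    ¬ W.HasCM → (∀ n : ℕ, W.HasSurjectiveModNGaloisRep ((2 ^ n : ℕ) : ℤ)) → Odd W.torsionOrder → Odd W.tamagawaProduct →
    W.analyticRank = 1 → 0 < W.Δ → ShaTwoTrivial W → ¬ MeetsEgg W →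
    ∀ (K : Type) [Field K] [NumberField K], IsImaginaryQuadratic K →
      DescAdmissible W (NumberField.discr K) →
      Nat.Coprime (NumberField.discr K).natAbs (W.conductorNorm ℤ) → SatisfiesHeegnerHypothesis (W.conductorNorm ℤ) K →
      SpinNondegenerateAt W (NumberField.discr K) →
      (W.quadraticTwist (NumberField.discr K : ℚ)).entireLFunction 1 ≠ 0 →
      ∀ (Dt : ModularParametrizationData W (W.conductorNorm ℤ))
        (H : HeegnerDatum (W.conductorNorm ℤ) (NumberField.discr K)) (ι : K →+* ℂ)
        (P : (W.baseChange K).toAffine.Point),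
        WeierstrassCurve.Affine.Point.map ι.toRatAlgHom P = heegnerPointComplex Dt H →
        HasTwoDivisibilityUpToTorsion W K P (padicValInt 2 Dt.c + 1)

/-- **S3 `ShaCardFourAtSpinDoorAtTwo` (SUPPORT; theorem-grade modulo print).**  At a spin-nondegenerate desc-admissible door of a `W` of the class,
a globally minimal model `Wd` of the twist has `#Ш(Wd)[2^∞] = 4` (v2: no `L`-value binder).  Ingredients: `#Sel₂(W^{(d)}) = 4` (PROVED egg twist law
`GenusKolyArch.eggTwistLawAtTwo_holds`), `rank Wd(ℚ) = 0` and `Ш(Wd)[2^∞]` finite (Kolyvagin at `L ≠ 0`), `Wd(ℚ)[2] = 0` (big image), and `r_4 = 0`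
(no element of order `4` in `Sel_{2^∞} = Ш[2^∞]`); plus model-independence of `Ш` and of `r_{2^k}` under `Cd •` and twisting conventions.  Why it is
not yet a tree theorem: the Selmer-algebra identification `Sel₂ ↪ Sel_{2^∞}[2]` onto for `E(ℚ)[2] = 0` in the tree's two currencies
(`selmerGroup W 2` versus `selmerGroupPInfty`); tagged as an open node (SUPPORT) for the audit.  v2 (gen 36, REF1 §434 rider R434a): the binder
`L(W^{(d)},1) ≠ 0` is DROPPED — `r_4 = 0` and `Sel_{2^∞}[2] = Sel₂ = (ℤ/2)²` with `Wd(ℚ)[2] = 0` force `Sel_{2^∞}(Wd) = (ℤ/2)²` outright, hence rank `0`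
and `Ш(Wd)[2^∞] = (ℤ/2)²` with no `L`-value input. [cite: Kramer1981, Prop. 6] [cite: Kolyvagin1990, Thm. A] [cite: SmithGoldfeld2025, Notation 1.8] -/
@[conjecture] def ShaCardFourAtSpinDoorAtTwo : Prop :=
  ∀ (W : WeierstrassCurve ℚ) [W.IsElliptic] [W.IsGloballyMinimal] [NeZero (W.conductorNorm ℤ)],
    ¬ W.HasCM → (∀ n : ℕ, W.HasSurjectiveModNGaloisRep ((2 ^ n : ℕ) : ℤ)) → Odd W.torsionOrder → Odd W.tamagawaProduct →
    W.analyticRank = 1 → 0 < W.Δ → ShaTwoTrivial W → ¬ MeetsEgg W →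
    ∀ d : ℤ, DescAdmissible W d → SpinNondegenerateAt W d →
      ∀ (Wd : WeierstrassCurve ℚ) [Wd.IsElliptic] [Wd.IsGloballyMinimal] (Cd : WeierstrassCurve.VariableChange ℚ),
        Cd • W.quadraticTwist (d : ℚ) = Wd → Nat.card (AddCommGroup.primaryComponent Wd.sha 2) = 4

/-- `ord₂ 4 = 2`. -/
private theorem padicValNat_two_four : padicValNat 2 4 = 2 := by
  have h : (4 : ℕ) = 2 ^ 2 := by norm_num
  rw [h, padicValNat.prime_pow]

/-- **THE KERNEL REDUCTION `R_N ⟸ S1 ∧ S2 ∧ S3`** (modulo modularity `exists_isNewformOf`, for a parametrisation datum and the `K`-rational Heegner point):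
at the spin door supplied by S1 take ANY parametrisation datum, a Heegner datum, an embedding and the `K`-rational Heegner point `P`; S2 gives the exponent
`m = v₂(c) + 1`; `Ш(W)[2] = 0` gives `s_W = 0`, S3 gives `s_d = 2`, desc-admissibility gives `t = s = 0` and `Δ_W > 0` kills `[Δ_W < 0]`; so the AN-28c
identity reads `2(v₂(c)+1) + 0 = 0 + 2 + 0 + 2·v₂(c)` and the datum is LAWFUL.  Hence the line of record's residue `DoorIndexLawFullCAtTwoSomeDoorResidueNonEgg`
on the whole `Δ_W > 0`, `Ш[2] = 0`, non-egg class.  CONDITIONAL by design (S1, S2 conjectures; S3 support); BSD is not proved by this.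
[cite: GrossLMS1991, Conj. 1.2, §3 and §10] [cite: Kramer1981, Prop. 6] [cite: GrossZagier1986, Thm. I.6.3 and V.§2] -/
theorem residueNonEgg_of_spinDoors (hnf : exists_isNewformOf)
    (h1 : SpinDoorExistsAtTwo) (h2 : SpinDoorHeegnerExponentAtTwo) (h3 : ShaCardFourAtSpinDoorAtTwo) :
    DoorIndexLawFullCAtTwoSomeDoorResidueNonEgg := by
  intro W _ _ _ hCM hsurj hT hc hr hΔ hSha hegg
  haveI : Fact (Nat.Prime 2) := ⟨Nat.prime_two⟩
  obtain ⟨K, iF, iN, hK, hDA, hcop, hHN, hspin, hLt⟩ := h1 W hCM hsurj hT hc hr hΔ hSha hegg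
  have hadm : DoorAdmissible W (NumberField.discr K) := ANg16.doorAdmissible_of_descAdmissible W hDA
  have hmin : transpCount W (NumberField.discr K) + 2 * identCount W (NumberField.discr K) = (if W.Δ < 0 then 1 else 0) :=
    minimal_of_descAdmissible_of_pos W hΔ hDA
  have hif : (if W.Δ < 0 then 1 else 0 : ℕ) = 0 := if_neg (not_lt.mpr hΔ.le)
  -- ANY parametrisation datum (modularity), a Heegner datum, an embedding, the `K`-rational Heegner point
  obtain ⟨Dt⟩ := (nonempty_modularParametrizationData_iff_exists_isNewformOf_unconditional.mpr hnf) W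
  obtain ⟨H, -⟩ :=
    nonempty_heegnerDatum_holds (W.conductorNorm ℤ) K hK (exists_dvd_sq_sub_discr_holds (W.conductorNorm ℤ) K hK hHN).choose_spec
  obtain ⟨ι⟩ : Nonempty (K →+* ℂ) := inferInstance
  obtain ⟨P, hP⟩ := heegnerPointComplex_mem_range_map_holds (W.conductorNorm ℤ) W K hK hHN Dt H ι
  -- S2: exponent `v₂(c) + 1`
  have hm : HasTwoDivisibilityUpToTorsion W K P (padicValInt 2 Dt.c + 1) :=
    h2 W hCM hsurj hT hc hr hΔ hSha hegg K hK hDA hcop hHN hspin hLt Dt H ι P hP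
  -- a globally minimal model of the twist; `s_W = 0`, `s_d = 2`
  have hD0 : (NumberField.discr K : ℚ) ≠ 0 := by exact_mod_cast NumberField.discr_ne_zero K
  haveI hEt : (W.quadraticTwist (NumberField.discr K : ℚ)).IsElliptic := W.isElliptic_quadraticTwist hD0
  obtain ⟨Cd, hCd⟩ := hasGlobalMinimalModel_rat_holds (W.quadraticTwist (NumberField.discr K : ℚ))
  haveI := hCd
  have hsW : padicValNat 2 (Nat.card (AddCommGroup.primaryComponent W.sha 2)) = 0 :=
    padicValNat_card_primaryComponent_sha_two_eq_zero_of_shaTwoTrivial W hSha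
  have hsd : padicValNat 2 (Nat.card (AddCommGroup.primaryComponent (Cd • W.quadraticTwist (NumberField.discr K : ℚ)).sha 2)) = 2 := by
    rw [h3 W hCM hsurj hT hc hr hΔ hSha hegg (NumberField.discr K) hDA hspin (Cd • W.quadraticTwist (NumberField.discr K : ℚ)) Cd rfl]
    exact padicValNat_two_four
  unfold HasLawfulDoorAtTwo
  refine ⟨K, iF, iN, hK, hadm, hLt, Dt, H, ι, P, Cd • W.quadraticTwist (NumberField.discr K : ℚ), inferInstance, hCd, Cd, hP, rfl,
    padicValInt 2 Dt.c + 1, hm, ?_⟩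
  rw [hsW, hsd, hif]
  rw [hif] at hmin
  omega

/-- **The density law implies the supply's spin half** (bookkeeping direction recorded informally: a set of relative density `1/2` is non-empty; the
`L ≠ 0` half of S1 is the rank-`0` `2`-converse).  Here only the trivial direction `S1 ⟹ some spin-nondegenerate door prime exists` is kernel-checked,
to certify that S1 speaks about the objects of §1. [cite: Kramer1981, Prop. 6] -/
theorem exists_spinNondegenerate_doorPrime_of_S1 (h1 : SpinDoorExistsAtTwo)
    (W : WeierstrassCurve ℚ) [W.IsElliptic] [W.IsGloballyMinimal] [NeZero (W.conductorNorm ℤ)]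
    (hCM : ¬ W.HasCM) (hsurj : ∀ n : ℕ, W.HasSurjectiveModNGaloisRep ((2 ^ n : ℕ) : ℤ)) (hT : Odd W.torsionOrder)
    (hc : Odd W.tamagawaProduct) (hr : W.analyticRank = 1) (hΔ : 0 < W.Δ) (hSha : ShaTwoTrivial W) (hegg : ¬ MeetsEgg W) :
    ∃ d : ℤ, DescAdmissible W d ∧ SpinNondegenerateAt W d := by
  obtain ⟨K, _, _, -, hDA, -, -, hspin, -⟩ := h1 W hCM hsurj hT hc hr hΔ hSha hegg
  exact ⟨NumberField.discr K, hDA, hspin⟩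

end Summit.BirchSwinnertonDyer.BirchSwinnertonDyer.Theorems.RankOneAtTwoSpinAtTwo

end
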